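import Literature.GroupTheory.CommensurableIndexRatio
import Literature.GroupTheory.OrbitIndexSum
import Mathlib.Algebra.BigOperators.Ring.Finset
import Mathlib.Algebra.Order.BigOperators.Group.Finset
import HarnessLib

/-!
# Class weights and the mass of a class set `U\G/K`

Topic `GroupTheory`.  Three DEFINITIONS (`classWeight`, `modularRatio`, `classMass`) over Mathlib's `Subgroup.relIndex` ∕ `DoubleCoset`, and
their calculus; the generalized index `q(A, B) := [B : A ⊓ B]/[A : A ⊓ B] = (A.relIndex B)/(B.relIndex A)` of
`CommensurableIndexRatio` stays written out.

SETTING ([ShimuraIATAF1971, §3.1–3.3]; [PlatonovRapinchuk1994, §8.1 «class number»]): a group `G` (in nature `G(𝔸_f)`), a subgroup `U`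
(in nature the rational points `G(ℚ)`), a family `𝒞` of pairwise commensurable subgroups stable under conjugation (the open compact
subgroups), a reference `K₀ ∈ 𝒞`.  For `K ∈ 𝒞` and `y ∈ G` put `Λ_y^K := U ⊓ yKy⁻¹` (the arithmetic group of the component of index `y`) and
* `classWeight U K₀ K y := q(Λ_y^K, U ⊓ K₀) · q(K₀, K)` — «covolume of `Λ_y^K` relative to `U ⊓ K₀`» times «volume of `K` relative to `K₀`»;
* `modularRatio K₀ g := q(K₀, gK₀g⁻¹)` — the modular function of `G` read on `K₀`;
* `classMass U K₀ K := Σ_{q ∈ U\G/K} classWeight U K₀ K q.out` — the MASS of the class set.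
Under the single analytic input (III) «`q(u(U ⊓ K₀)u⁻¹, U ⊓ K₀) = 1` for `u ∈ U`» (unimodularity of the commensurator of an arithmetic lattice,
[ShimuraIATAF1971, Prop. 3.6]; the tree's row `CocompactLatticeCommensuratorIndexEq`) we prove:
(W0) `0 < classWeight`; (W1) `classWeight K (uyk) = classWeight K y` (`u ∈ U`, `k ∈ K`); (W2) `Σ_{U y' K' ⊂ U y K} classWeight K' y' =
classWeight K y` for `K' ≤ K` (the cover-degree count `sum_fibre_relIndex_inf_map_conj`); (W3) `classWeight (gKg⁻¹) y = modularRatio g ·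
classWeight K (yg)`; (M1) `classMass K' = classMass K` (`K' ≤ K`); (M2) `classMass (gKg⁻¹) = modularRatio g · classMass K`; and hence, comparing
`K`, `gKg⁻¹` through `K ⊓ gKg⁻¹`, (M3) `modularRatio g = 1` — the MASS TRICK: the level forms weighted by `classWeight` are honestly invariant.
CONSUMER: hodgecm-mathlib binder `h413`, stub (b) `StubUnitarizableAtPin` (A-p10 `SPEC-b6-LevelFormAssembly.md`).

## References
* [ShimuraIATAF1971] G. Shimura, *Introduction to the Arithmetic Theory of Automorphic Functions* (1971), §3.1 Prop. 3.1, §3.3 Prop. 3.6.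
* [PlatonovRapinchuk1994] V. Platonov, A. Rapinchuk, *Algebraic Groups and Number Theory* (1994), §8.1 (class sets `G(𝔸_f) = ⊔ G(ℚ) xᵢ K`).
-/

namespace Literature.GroupTheory

open Subgroup

variable {G : Type*} [Group G]

/-! ## §0 Conjugation algebra and sums over class sets -/

/-- `(ab) L (ab)⁻¹ = a (b L b⁻¹) a⁻¹`. [cite: ShimuraIATAF1971, §3.1] -/
theorem map_conj_mul (L : Subgroup G) (a b : G) :
    L.map (MulAut.conj (a * b)).toMonoidHom = (L.map (MulAut.conj b).toMonoidHom).map (MulAut.conj a).toMonoidHom := by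
  rw [Subgroup.map_map]
  congr 1
  ext g
  simp [MulAut.conj_apply, mul_assoc]

/-- `γ Γ γ⁻¹ = Γ` for `γ ∈ Γ`. [cite: ShimuraIATAF1971, §3.1] -/
theorem map_conj_eq_self_of_mem (Γ : Subgroup G) {γ : G} (hγ : γ ∈ Γ) : Γ.map (MulAut.conj γ).toMonoidHom = Γ := by
  ext g
  rw [mem_map_conj_iff]
  constructor
  · intro h
    have h' := Γ.mul_mem (Γ.mul_mem hγ h) (Γ.inv_mem hγ)
    simpa [mul_assoc] using h'
  · intro h
    exact Γ.mul_mem (Γ.mul_mem (Γ.inv_mem hγ) h) hγ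

/-- `γ (Γ ∩ L) γ⁻¹ = Γ ∩ γLγ⁻¹` for `γ ∈ Γ`. [cite: ShimuraIATAF1971, §3.1] -/
theorem map_inf_conj_of_mem (Γ L : Subgroup G) {γ : G} (hγ : γ ∈ Γ) :
    (Γ ⊓ L).map (MulAut.conj γ).toMonoidHom = Γ ⊓ L.map (MulAut.conj γ).toMonoidHom := by
  rw [Subgroup.map_inf _ _ _ (MulAut.conj γ).injective, map_conj_eq_self_of_mem Γ hγ]

/-- `Γ ∩ (γy)L(γy)⁻¹ = γ (Γ ∩ yLy⁻¹) γ⁻¹` for `γ ∈ Γ`. [cite: ShimuraIATAF1971, §3.1] -/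
theorem inf_map_conj_mul_of_mem (Γ L : Subgroup G) (y : G) {γ : G} (hγ : γ ∈ Γ) :
    Γ ⊓ L.map (MulAut.conj (γ * y)).toMonoidHom = (Γ ⊓ L.map (MulAut.conj y).toMonoidHom).map (MulAut.conj γ).toMonoidHom := by
  rw [map_conj_mul, ← map_inf_conj_of_mem Γ _ hγ]

/-- Intersecting with a fixed subgroup preserves commensurability. [cite: ShimuraIATAF1971, §3.1] -/
theorem commensurable_inf_left (U : Subgroup G) {K K' : Subgroup G} (h : Commensurable K K') :
    Commensurable (U ⊓ K) (U ⊓ K') := by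
  constructor
  · have h1 := Subgroup.relIndex_inter_ne_zero h.1 U
    rwa [inf_comm K U, inf_comm K' U] at h1
  · have h2 := Subgroup.relIndex_inter_ne_zero h.2 U
    rwa [inf_comm K' U, inf_comm K U] at h2

/-- Conjugation preserves commensurability. [cite: ShimuraIATAF1971, §3.1] -/
theorem commensurable_map_conj {A B : Subgroup G} (h : Commensurable A B) (g : G) :
    Commensurable (A.map (MulAut.conj g).toMonoidHom) (B.map (MulAut.conj g).toMonoidHom) := by
  constructor
  · rw [Subgroup.relIndex_map_map_of_injective _ _ (MulAut.conj g).injective]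
    exact h.1
  · rw [Subgroup.relIndex_map_map_of_injective _ _ (MulAut.conj g).injective]
    exact h.2

/-- The relation of `U\G/(gKg⁻¹)` on `a, b` is the relation of `U\G/K` on `ag, bg`. [cite: PlatonovRapinchuk1994, §8.1] -/
theorem doubleCoset_rel_map_conj_iff (U K : Subgroup G) (g a b : G) :
    (DoubleCoset.setoid (U : Set G) (K.map (MulAut.conj g).toMonoidHom : Set G)) a b ↔
      (DoubleCoset.setoid (U : Set G) (K : Set G)) (a * g) (b * g) := by
  rw [DoubleCoset.rel_iff, DoubleCoset.rel_iff]
  constructor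
  · rintro ⟨u, hu, k, hk, rfl⟩
    refine ⟨u, hu, g⁻¹ * k * g, (mem_map_conj_iff K g k).mp hk, by simp [mul_assoc]⟩
  · rintro ⟨u, hu, k, hk, he⟩
    refine ⟨u, hu, g * k * g⁻¹, (mem_map_conj_iff K g _).mpr (by simpa [mul_assoc] using hk), ?_⟩
    calc b = b * g * g⁻¹ := by simp
      _ = u * (a * g) * k * g⁻¹ := by rw [he]
      _ = u * a * (g * k * g⁻¹) := by simp [mul_assoc]

/-- **Re-indexing a class sum along `y ↦ yg`**: for a class function `F` (`F (uyk) = F y`, `u ∈ U`, `k ∈ K`),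
`Σ_{q ∈ U\G/(gKg⁻¹)} F (q.out · g) = Σ_{q ∈ U\G/K} F q.out` (the bijection `U y (gKg⁻¹) ↦ U (yg) K`). [cite: PlatonovRapinchuk1994, §8.1] -/
theorem sum_quotient_map_conj_eq {M : Type*} [AddCommMonoid M] (U K : Subgroup G) (g : G)
    [Fintype (DoubleCoset.Quotient (U : Set G) (K : Set G))]
    [Fintype (DoubleCoset.Quotient (U : Set G) (K.map (MulAut.conj g).toMonoidHom : Set G))]
    (F : G → M) (hF : ∀ (y : G), ∀ u ∈ U, ∀ k ∈ K, F (u * y * k) = F y) :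
    ∑ q : DoubleCoset.Quotient (U : Set G) (K.map (MulAut.conj g).toMonoidHom : Set G), F (q.out * g) =
      ∑ q : DoubleCoset.Quotient (U : Set G) (K : Set G), F q.out := by
  let e : DoubleCoset.Quotient (U : Set G) (K.map (MulAut.conj g).toMonoidHom : Set G) ≃ DoubleCoset.Quotient (U : Set G) (K : Set G) :=
    Quotient.congr (Equiv.mulRight g) (fun a b => doubleCoset_rel_map_conj_iff U K g a b)
  refine Fintype.sum_equiv e _ _ (fun q => ?_)
  have heq : e (DoubleCoset.mk U (K.map (MulAut.conj g).toMonoidHom) q.out) = DoubleCoset.mk U K (q.out * g) := rfl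
  rw [DoubleCoset.out_eq'] at heq
  have h2 : DoubleCoset.mk U K (q.out * g) = DoubleCoset.mk U K (e q).out := by rw [← heq, DoubleCoset.out_eq']
  obtain ⟨u, hu, k, hk, he⟩ := (DoubleCoset.eq U K _ _).mp h2
  rw [he, hF _ u hu k hk]

/-- **Regrouping a class sum by fibres**: `Σ_{q' ∈ U\G/K'} F q' = Σ_{q ∈ U\G/K} Σ_{q' : U q'.out K = U q.out K} F q'` (any `K, K'`; each `q'` lies in
exactly one fibre). [cite: PlatonovRapinchuk1994, §8.1] -/
theorem sum_quotient_eq_sum_fibre {M : Type*} [AddCommMonoid M] (U K K' : Subgroup G)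
    [Fintype (DoubleCoset.Quotient (U : Set G) (K' : Set G))] [Fintype (DoubleCoset.Quotient (U : Set G) (K : Set G))]
    [DecidableEq (DoubleCoset.Quotient (U : Set G) (K : Set G))] (F : DoubleCoset.Quotient (U : Set G) (K' : Set G) → M) :
    ∑ q' : DoubleCoset.Quotient (U : Set G) (K' : Set G), F q' =
      ∑ q : DoubleCoset.Quotient (U : Set G) (K : Set G),
        ∑ q' ∈ Finset.univ.filter (fun q' : DoubleCoset.Quotient (U : Set G) (K' : Set G) =>
          DoubleCoset.mk U K q'.out = DoubleCoset.mk U K q.out), F q' := by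
  rw [← Finset.sum_fiberwise Finset.univ (fun q' : DoubleCoset.Quotient (U : Set G) (K' : Set G) => DoubleCoset.mk U K q'.out) F]
  refine Finset.sum_congr rfl (fun q _ => ?_)
  have hq : DoubleCoset.mk U K q.out = q := DoubleCoset.out_eq' U K q
  rw [hq]

/-! ## §1 The definitions -/

/-- **The CLASS WEIGHT** of the index `y` at level `K` (relative to `U` and the reference `K₀`):
`classWeight U K₀ K y := q(U ⊓ yKy⁻¹, U ⊓ K₀) · q(K₀, K)`, `q(A, B) = [B : A ⊓ B]/[A : A ⊓ B]` — in nature (`G = G(𝔸_f)`, `U = G(ℚ)`, `K, K₀` open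
compact) the covolume of the arithmetic group `G(ℚ) ∩ yKy⁻¹` (normalised by that of `G(ℚ) ∩ K₀`) times the Haar volume of `K` (normalised by that of
`K₀`). [cite: ShimuraIATAF1971, §3.1 and §3.3] -/
noncomputable def classWeight (U K₀ K : Subgroup G) (y : G) : ℚ :=
  ((U ⊓ K.map (MulAut.conj y).toMonoidHom).relIndex (U ⊓ K₀) : ℚ) /
      ((U ⊓ K₀).relIndex (U ⊓ K.map (MulAut.conj y).toMonoidHom) : ℚ) *
    ((K₀.relIndex K : ℚ) / (K.relIndex K₀ : ℚ))

/-- **The MODULAR RATIO** `modularRatio K₀ g := q(K₀, gK₀g⁻¹) = [gK₀g⁻¹ : K₀ ∩ gK₀g⁻¹]/[K₀ : K₀ ∩ gK₀g⁻¹]` — in nature `μ(gK₀g⁻¹)/μ(K₀) = Δ_G(g)`, the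
modular function read on the open compact `K₀`. [cite: ShimuraIATAF1971, §3.3 Prop. 3.6] -/
noncomputable def modularRatio (K₀ : Subgroup G) (g : G) : ℚ :=
  (K₀.relIndex (K₀.map (MulAut.conj g).toMonoidHom) : ℚ) / ((K₀.map (MulAut.conj g).toMonoidHom).relIndex K₀ : ℚ)

/-- **The MASS of the class set `U\G/K`**: `classMass U K₀ K := Σ_{q ∈ U\G/K} classWeight U K₀ K q.out` (finite class set assumed) — in nature
`Σᵢ covol(G(ℚ) ∩ xᵢ K xᵢ⁻¹) · vol(K)` over `G(𝔸_f) = ⊔ᵢ G(ℚ) xᵢ K`, i.e. `vol(G(ℚ)\G(𝔸_f))`: independent of `K`.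
[cite: PlatonovRapinchuk1994, §8.1] [cite: ShimuraIATAF1971, §3.3] -/
noncomputable def classMass (U K₀ K : Subgroup G) [Fintype (DoubleCoset.Quotient (U : Set G) (K : Set G))] : ℚ :=
  ∑ q : DoubleCoset.Quotient (U : Set G) (K : Set G), classWeight U K₀ K q.out

/-! ## §2 The weight calculus (W0)–(W3) -/

section Weights

variable {𝒞 : Set (Subgroup G)} {U K₀ : Subgroup G}

/-- (W0) **Positivity**: `0 < classWeight U K₀ K y` (all the groups involved are commensurable). [cite: ShimuraIATAF1971, §3.1] -/
theorem classWeight_pos (h𝒞c : ∀ K ∈ 𝒞, ∀ g : G, K.map (MulAut.conj g).toMonoidHom ∈ 𝒞)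
    (h𝒞 : ∀ K ∈ 𝒞, ∀ K' ∈ 𝒞, Commensurable K K') (hK₀ : K₀ ∈ 𝒞) {K : Subgroup G} (hK : K ∈ 𝒞) (y : G) :
    0 < classWeight U K₀ K y := by
  unfold classWeight
  exact mul_pos (relIndexRatio_pos (commensurable_inf_left U (h𝒞 _ (h𝒞c K hK y) _ hK₀))) (relIndexRatio_pos (h𝒞 _ hK₀ _ hK))

/-- (W1) **Class invariance**: `classWeight K (u y k) = classWeight K y` for `u ∈ U`, `k ∈ K` — `(uyk)K(uyk)⁻¹ = u (yKy⁻¹) u⁻¹`, so the arithmetic group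
is conjugated by `u ∈ U`, and `q(uΛu⁻¹, U ⊓ K₀) = q(uΛu⁻¹, u(U ⊓ K₀)u⁻¹) · q(u(U ⊓ K₀)u⁻¹, U ⊓ K₀) = q(Λ, U ⊓ K₀) · 1` by the input (III).
[cite: ShimuraIATAF1971, §3.3 Prop. 3.6] -/
theorem classWeight_mul_of_mem (h𝒞c : ∀ K ∈ 𝒞, ∀ g : G, K.map (MulAut.conj g).toMonoidHom ∈ 𝒞)
    (h𝒞 : ∀ K ∈ 𝒞, ∀ K' ∈ 𝒞, Commensurable K K') (hK₀ : K₀ ∈ 𝒞)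
    (hIII : ∀ u ∈ U, ((U ⊓ K₀).map (MulAut.conj u).toMonoidHom).relIndex (U ⊓ K₀) =
      (U ⊓ K₀).relIndex ((U ⊓ K₀).map (MulAut.conj u).toMonoidHom))
    {K : Subgroup G} (hK : K ∈ 𝒞) (y : G) {u k : G} (hu : u ∈ U) (hk : k ∈ K) :
    classWeight U K₀ K (u * y * k) = classWeight U K₀ K y := by
  unfold classWeight
  congr 1
  rw [map_conj_mul_of_mem K (u * y) hk, inf_map_conj_mul_of_mem U K y hu]
  set Λ : Subgroup G := U ⊓ K.map (MulAut.conj y).toMonoidHom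
  set Λ₀ : Subgroup G := U ⊓ K₀
  have hΛ : Commensurable Λ Λ₀ := commensurable_inf_left U (h𝒞 _ (h𝒞c K hK y) _ hK₀)
  have h0u0 : Commensurable (Λ₀.map (MulAut.conj u).toMonoidHom) Λ₀ := by
    rw [map_inf_conj_of_mem U K₀ hu]
    exact commensurable_inf_left U (h𝒞 _ (h𝒞c K₀ hK₀ u) _ hK₀)
  have hΛu0 : Commensurable (Λ.map (MulAut.conj u).toMonoidHom) Λ₀ := (commensurable_map_conj hΛ u).trans h0u0
  rw [relIndexRatio_trans (commensurable_map_conj hΛ u) h0u0 hΛu0, relIndexRatio_conj u Λ Λ₀]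
  have h1 : ((Λ₀.map (MulAut.conj u).toMonoidHom).relIndex Λ₀ : ℚ) / (Λ₀.relIndex (Λ₀.map (MulAut.conj u).toMonoidHom) : ℚ) = 1 := by
    rw [hIII u hu]
    exact div_self (by exact_mod_cast h0u0.2)
  rw [h1, mul_one]

/-- (W3) **Translates**: `classWeight (gKg⁻¹) y = modularRatio g · classWeight K (yg)` — `y(gKg⁻¹)y⁻¹ = (yg)K(yg)⁻¹` (same arithmetic group) and
`q(K₀, gKg⁻¹) = q(K₀, gK₀g⁻¹) · q(K₀, K)`. [cite: ShimuraIATAF1971, §3.3] -/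
theorem classWeight_map_conj (h𝒞c : ∀ K ∈ 𝒞, ∀ g : G, K.map (MulAut.conj g).toMonoidHom ∈ 𝒞)
    (h𝒞 : ∀ K ∈ 𝒞, ∀ K' ∈ 𝒞, Commensurable K K') (hK₀ : K₀ ∈ 𝒞) {K : Subgroup G} (hK : K ∈ 𝒞) (g y : G) :
    classWeight U K₀ (K.map (MulAut.conj g).toMonoidHom) y = modularRatio K₀ g * classWeight U K₀ K (y * g) := by
  unfold classWeight modularRatio
  rw [← map_conj_mul K y g,
    relIndexRatio_conj_eq_mul g (h𝒞 _ hK₀ _ hK) (h𝒞 _ hK₀ _ (h𝒞c K₀ hK₀ g)) (h𝒞 _ hK₀ _ (h𝒞c K hK g))]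
  ring

/-- (W2) **Refinement**: for `K' ≤ K` of finite index and an index `x`, summing the `K'`-weights over the `(U, K')`-classes inside `U x K` gives the
`K`-weight of `x`: `Σ_{U x' K' ⊂ U x K} classWeight K' x' = classWeight K x` — termwise `classWeight K' x' = [U ∩ x'Kx'⁻¹ : U ∩ x'K'x'⁻¹] ·
q(U ∩ xKx⁻¹, U ⊓ K₀) · q(K₀, K)/[K : K']` ((W1) and `q(K₀, K') = q(K₀, K)/[K : K']`), and the cover-degree count
`Σ [U ∩ x'Kx'⁻¹ : U ∩ x'K'x'⁻¹] = [K : K']`. [cite: ShimuraIATAF1971, §3.1 Prop. 3.1 and §3.3] -/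
theorem sum_fibre_classWeight (h𝒞c : ∀ K ∈ 𝒞, ∀ g : G, K.map (MulAut.conj g).toMonoidHom ∈ 𝒞)
    (h𝒞 : ∀ K ∈ 𝒞, ∀ K' ∈ 𝒞, Commensurable K K') (hK₀ : K₀ ∈ 𝒞)
    (hIII : ∀ u ∈ U, ((U ⊓ K₀).map (MulAut.conj u).toMonoidHom).relIndex (U ⊓ K₀) =
      (U ⊓ K₀).relIndex ((U ⊓ K₀).map (MulAut.conj u).toMonoidHom))
    {K K' : Subgroup G} (hK : K ∈ 𝒞) (hK' : K' ∈ 𝒞) (hle : K' ≤ K) [K'.IsFiniteRelIndex K] (x : G)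
    [Fintype (DoubleCoset.Quotient (U : Set G) (K' : Set G))] [DecidableEq (DoubleCoset.Quotient (U : Set G) (K : Set G))] :
    ∑ q' ∈ Finset.univ.filter (fun q' : DoubleCoset.Quotient (U : Set G) (K' : Set G) =>
        DoubleCoset.mk U K q'.out = DoubleCoset.mk U K x), classWeight U K₀ K' q'.out = classWeight U K₀ K x := by
  have hKK' : (K'.relIndex K : ℚ) ≠ 0 := by exact_mod_cast Subgroup.relIndex_ne_zero
  -- termwise
  have hterm : ∀ q' ∈ Finset.univ.filter (fun q' : DoubleCoset.Quotient (U : Set G) (K' : Set G) =>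
      DoubleCoset.mk U K q'.out = DoubleCoset.mk U K x),
      classWeight U K₀ K' q'.out =
        ((U ⊓ K'.map (MulAut.conj q'.out).toMonoidHom).relIndex (U ⊓ K.map (MulAut.conj q'.out).toMonoidHom) : ℚ) *
          (classWeight U K₀ K x / (K'.relIndex K : ℚ)) := by
    intro q' hq'
    rw [Finset.mem_filter] at hq'
    obtain ⟨u, hu, k, hk, he⟩ := (DoubleCoset.eq U K x q'.out).mp hq'.2.symm
    have hWx : classWeight U K₀ K q'.out = classWeight U K₀ K x := by
      rw [he]
      exact classWeight_mul_of_mem h𝒞c h𝒞 hK₀ hIII hK x hu hk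
    rw [← hWx]
    unfold classWeight
    set x' := q'.out
    set Λ : Subgroup G := U ⊓ K.map (MulAut.conj x').toMonoidHom
    set Λ' : Subgroup G := U ⊓ K'.map (MulAut.conj x').toMonoidHom
    set Λ₀ : Subgroup G := U ⊓ K₀
    have hΛ'Λ : Λ' ≤ Λ := inf_le_inf_left U (Subgroup.map_mono hle)
    have cΛΛ₀ : Commensurable Λ Λ₀ := commensurable_inf_left U (h𝒞 _ (h𝒞c K hK x') _ hK₀)
    have cΛ'Λ₀ : Commensurable Λ' Λ₀ := commensurable_inf_left U (h𝒞 _ (h𝒞c K' hK' x') _ hK₀)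
    have cΛ'Λ : Commensurable Λ' Λ := commensurable_inf_left U (h𝒞 _ (h𝒞c K' hK' x') _ (h𝒞c K hK x'))
    rw [relIndexRatio_trans cΛ'Λ cΛΛ₀ cΛ'Λ₀, Subgroup.relIndex_eq_one.mpr hΛ'Λ, Nat.cast_one, div_one]
    have hν : (K₀.relIndex K' : ℚ) / (K'.relIndex K₀ : ℚ) = (K₀.relIndex K : ℚ) / (K.relIndex K₀ : ℚ) / (K'.relIndex K : ℚ) := by
      rw [← relIndexRatio_refine hle (h𝒞 _ hK₀ _ hK) (h𝒞 _ hK₀ _ hK') (h𝒞 _ hK _ hK')]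
      field_simp
    rw [hν]
    ring
  rw [Finset.sum_congr rfl hterm, ← Finset.sum_mul, ← Nat.cast_sum, sum_fibre_relIndex_inf_map_conj U K K' hle x]
  field_simp

end Weights

/-! ## §3 The mass: refinement invariance, translates, and the mass trick -/

section Mass

variable {𝒞 : Set (Subgroup G)} {U K₀ : Subgroup G}

/-- **The mass is positive.** [cite: ShimuraIATAF1971, §3.3] -/
theorem classMass_pos (h𝒞c : ∀ K ∈ 𝒞, ∀ g : G, K.map (MulAut.conj g).toMonoidHom ∈ 𝒞)
    (h𝒞 : ∀ K ∈ 𝒞, ∀ K' ∈ 𝒞, Commensurable K K') (hK₀ : K₀ ∈ 𝒞) {K : Subgroup G} (hK : K ∈ 𝒞)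
    [Fintype (DoubleCoset.Quotient (U : Set G) (K : Set G))] : 0 < classMass U K₀ K := by
  unfold classMass
  exact Finset.sum_pos (fun q _ => classWeight_pos h𝒞c h𝒞 hK₀ hK q.out) Finset.univ_nonempty

/-- (M1) **The mass does not see the level**: `classMass K' = classMass K` for `K' ≤ K` of finite index (regroup `U\G/K'` along the fibres of
`U\G/K' → U\G/K` and use (W2)). [cite: ShimuraIATAF1971, §3.3] [cite: PlatonovRapinchuk1994, §8.1] -/
theorem classMass_eq_of_le (h𝒞c : ∀ K ∈ 𝒞, ∀ g : G, K.map (MulAut.conj g).toMonoidHom ∈ 𝒞)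
    (h𝒞 : ∀ K ∈ 𝒞, ∀ K' ∈ 𝒞, Commensurable K K') (hK₀ : K₀ ∈ 𝒞)
    (hIII : ∀ u ∈ U, ((U ⊓ K₀).map (MulAut.conj u).toMonoidHom).relIndex (U ⊓ K₀) =
      (U ⊓ K₀).relIndex ((U ⊓ K₀).map (MulAut.conj u).toMonoidHom))
    {K K' : Subgroup G} (hK : K ∈ 𝒞) (hK' : K' ∈ 𝒞) (hle : K' ≤ K) [K'.IsFiniteRelIndex K]
    [Fintype (DoubleCoset.Quotient (U : Set G) (K' : Set G))] [Fintype (DoubleCoset.Quotient (U : Set G) (K : Set G))] :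
    classMass U K₀ K' = classMass U K₀ K := by
  classical
  unfold classMass
  rw [sum_quotient_eq_sum_fibre U K K' (fun q' => classWeight U K₀ K' q'.out)]
  exact Finset.sum_congr rfl (fun q _ => sum_fibre_classWeight h𝒞c h𝒞 hK₀ hIII hK hK' hle q.out)

/-- (M2) **Translates**: `classMass (gKg⁻¹) = modularRatio g · classMass K` ((W3) termwise, then re-index `U\G/(gKg⁻¹) ≃ U\G/K` along `y ↦ yg`
using (W1)). [cite: ShimuraIATAF1971, §3.3] [cite: PlatonovRapinchuk1994, §8.1] -/
theorem classMass_map_conj (h𝒞c : ∀ K ∈ 𝒞, ∀ g : G, K.map (MulAut.conj g).toMonoidHom ∈ 𝒞)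
    (h𝒞 : ∀ K ∈ 𝒞, ∀ K' ∈ 𝒞, Commensurable K K') (hK₀ : K₀ ∈ 𝒞)
    (hIII : ∀ u ∈ U, ((U ⊓ K₀).map (MulAut.conj u).toMonoidHom).relIndex (U ⊓ K₀) =
      (U ⊓ K₀).relIndex ((U ⊓ K₀).map (MulAut.conj u).toMonoidHom))
    {K : Subgroup G} (hK : K ∈ 𝒞) (g : G) [Fintype (DoubleCoset.Quotient (U : Set G) (K : Set G))]
    [Fintype (DoubleCoset.Quotient (U : Set G) (K.map (MulAut.conj g).toMonoidHom : Set G))] :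
    classMass U K₀ (K.map (MulAut.conj g).toMonoidHom) = modularRatio K₀ g * classMass U K₀ K := by
  unfold classMass
  simp_rw [classWeight_map_conj h𝒞c h𝒞 hK₀ hK g]
  rw [← Finset.mul_sum, sum_quotient_map_conj_eq U K g (classWeight U K₀ K)
    (fun y u hu k hk => classWeight_mul_of_mem h𝒞c h𝒞 hK₀ hIII hK y hu hk)]

/-- (M3) **THE MASS TRICK — the modular ratio is trivial**: if `K`, `gKg⁻¹` and `K ⊓ gKg⁻¹` are levels (finite class sets, finite indices), then
`modularRatio K₀ g = 1`: by (M1) twice `classMass (gKg⁻¹) = classMass (K ⊓ gKg⁻¹) = classMass K`, by (M2) `classMass (gKg⁻¹) = modularRatio g ·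
classMass K`, and the mass is positive.  (In nature: a group carrying a lattice is unimodular, [ShimuraIATAF1971, Prop. 3.6]; here the archimedean
input (III) is converted into the triviality of the non-archimedean modular function through the finiteness of the class set.)
[cite: ShimuraIATAF1971, §3.3 Prop. 3.6] [cite: PlatonovRapinchuk1994, §8.1] -/
theorem modularRatio_eq_one (h𝒞c : ∀ K ∈ 𝒞, ∀ g : G, K.map (MulAut.conj g).toMonoidHom ∈ 𝒞)
    (h𝒞 : ∀ K ∈ 𝒞, ∀ K' ∈ 𝒞, Commensurable K K') (hK₀ : K₀ ∈ 𝒞)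
    (hIII : ∀ u ∈ U, ((U ⊓ K₀).map (MulAut.conj u).toMonoidHom).relIndex (U ⊓ K₀) =
      (U ⊓ K₀).relIndex ((U ⊓ K₀).map (MulAut.conj u).toMonoidHom))
    {K : Subgroup G} (hK : K ∈ 𝒞) (g : G) (hKg : K ⊓ K.map (MulAut.conj g).toMonoidHom ∈ 𝒞)
    [(K ⊓ K.map (MulAut.conj g).toMonoidHom).IsFiniteRelIndex K]
    [(K ⊓ K.map (MulAut.conj g).toMonoidHom).IsFiniteRelIndex (K.map (MulAut.conj g).toMonoidHom)]
    [Fintype (DoubleCoset.Quotient (U : Set G) (K : Set G))]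
    [Fintype (DoubleCoset.Quotient (U : Set G) (K.map (MulAut.conj g).toMonoidHom : Set G))]
    [Fintype (DoubleCoset.Quotient (U : Set G) (K ⊓ K.map (MulAut.conj g).toMonoidHom : Set G))] :
    modularRatio K₀ g = 1 := by
  have h1 := classMass_eq_of_le h𝒞c h𝒞 hK₀ hIII hK hKg inf_le_left
  have h2 := classMass_eq_of_le h𝒞c h𝒞 hK₀ hIII (h𝒞c K hK g) hKg inf_le_right
  have h3 := classMass_map_conj h𝒞c h𝒞 hK₀ hIII hK g
  have hpos := classMass_pos h𝒞c h𝒞 hK₀ hK (U := U)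
  rw [← h2, h1] at h3
  exact ((mul_eq_right₀ hpos.ne').mp h3.symm)

end Mass

end Literature.GroupTheory
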